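import Literature.Computability.ImplicitComplexity.SoftTypeAssignmentWeighted
import HarnessLib

/-!
# `STA₊` weighted derivations are invariant under injective renaming of variable slots

Continuation of `SoftTypeAssignmentWeighted.lean` (GMR08 = Gaboardi–Marion–Ronchi Della Rocca
2008, the judgement `STA.WTyping r w d Γ M σ` = `STA₊` typing with degree, rank bound and weight).
Contexts are maps from variable slots `ℕ` to assumptions; a derivation can be replayed verbatim
after any injective renaming `ρ` of the slots, on the transported context `Ctx.remap ρ Γ` (slot
`ρ i` gets the assumption of slot `i`, slots off the range get none): `WTyping.rename`. This is
the de Bruijn form of "derivations are closed under renaming of variables" and is what makes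
fresh copies of a derivation available (substitution lemma, rule `(m)` in subject reduction); the
special case `ρ = succ` is the passage under a new, unused binder (`WTyping.shift_succ`).
Folklore; degree, rank bound and weight are unchanged.

## References

* [GaboardiMarionRonchidellarocca2008] GMR08, Table 2 (the rules are closed under renaming).
-/

namespace Literature.Computability.ImplicitComplexity

namespace STA

/-! ### Invariance under injective renaming of the variable slots -/

open Classical in
/-- Transport of a context along a renaming `ρ` of slots: slot `ρ i` receives the assumption of
slot `i`, slots outside the range receive nothing (meaningful for injective `ρ`). [folklore] -/
noncomputable def Ctx.remap (ρ : ℕ → ℕ) (Γ : Ctx) : Ctx := fun j =>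
  if h : ∃ i, ρ i = j then Γ h.choose else none

namespace Ctx

variable {ρ : ℕ → ℕ}

/-- The transported context at a renamed slot. [folklore] -/
theorem remap_apply (hρ : Function.Injective ρ) (Γ : Ctx) (i : ℕ) : Γ.remap ρ (ρ i) = Γ i := by
  unfold remap
  have h : ∃ i', ρ i' = ρ i := ⟨i, rfl⟩
  rw [dif_pos h]
  exact congrArg Γ (hρ h.choose_spec)

/-- The transported context outside the range. [folklore] -/
theorem remap_of_forall_ne (Γ : Ctx) {j : ℕ} (h : ∀ i, ρ i ≠ j) : Γ.remap ρ j = none := by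
  unfold remap
  rw [dif_neg]
  exact fun ⟨i, hi⟩ => h i hi

/-- Pointwise characterisation principle for transported contexts. [folklore] -/
theorem remap_eq_of (hρ : Function.Injective ρ) (Γ : Ctx) (Θ : Ctx) (h₁ : ∀ i, Θ (ρ i) = Γ i)
    (h₂ : ∀ j, (∀ i, ρ i ≠ j) → Θ j = none) : Γ.remap ρ = Θ := by
  funext j
  by_cases h : ∃ i, ρ i = j
  · obtain ⟨i, rfl⟩ := h
    rw [remap_apply hρ, h₁]
  · push Not at h
    rw [remap_of_forall_ne Γ h, h₂ j h]

/-- Transport commutes with updating a slot. [folklore] -/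
theorem remap_update (hρ : Function.Injective ρ) (Γ : Ctx) (j : ℕ) (a : Option SoftTy) :
    Ctx.remap ρ (Function.update Γ j a) = Function.update (Γ.remap ρ) (ρ j) a := by
  refine remap_eq_of hρ _ _ (fun i => ?_) (fun j' hj' => ?_)
  · by_cases hij : i = j
    · subst hij
      simp
    · rw [Function.update_of_ne (hρ.ne hij), Function.update_of_ne hij, remap_apply hρ]
  · rw [Function.update_of_ne (hj' j).symm, remap_of_forall_ne Γ hj']

/-- Lifting an injective renaming under a binder is injective. [folklore] -/
theorem _root_.Literature.Computability.ImplicitComplexity.STA.liftRen_injective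
    (hρ : Function.Injective ρ) : Function.Injective (liftRen ρ) := by
  intro a b h
  cases a with
  | zero =>
    cases b with
    | zero => rfl
    | succ b => exact absurd h (by simp [liftRen])
  | succ a =>
    cases b with
    | zero => exact absurd h (by simp [liftRen])
    | succ b =>
      have : ρ a = ρ b := by simpa [liftRen] using h
      rw [hρ this]

/-- Transport along a lifted renaming commutes with entering a binder. [folklore] -/
theorem remap_cons_liftRen (hρ : Function.Injective ρ) (a : Option SoftTy) (Γ : Ctx) :
    (Ctx.cons a Γ).remap (liftRen ρ) = Ctx.cons a (Γ.remap ρ) := by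
  refine remap_eq_of (liftRen_injective hρ) _ _ (fun i => ?_) (fun j hj => ?_)
  · cases i with
    | zero => rfl
    | succ i => exact remap_apply hρ Γ i
  · cases j with
    | zero => exact absurd rfl (hj 0)
    | succ j => exact remap_of_forall_ne Γ fun i hi => hj (i + 1) (by simp [liftRen, hi])

/-- Transport along `succ` is the shift entering a binder with no assumption. [folklore] -/
theorem remap_succ (Γ : Ctx) : Γ.remap Nat.succ = Ctx.cons none Γ :=
  remap_eq_of Nat.succ_injective _ _ (fun _ => rfl) fun j hj => by
    cases j with
    | zero => rfl
    | succ j => exact absurd rfl (hj j)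

/-- Transport commutes with `!Γ`. [folklore] -/
theorem remap_bang (hρ : Function.Injective ρ) (Γ : Ctx) : (Γ.bang).remap ρ = (Γ.remap ρ).bang :=
  remap_eq_of hρ _ _ (fun i => by simp [Ctx.bang, remap_apply hρ])
    fun j hj => by simp [Ctx.bang, remap_of_forall_ne Γ hj]

/-- Transport commutes with the type-variable shift. [folklore] -/
theorem remap_shift (hρ : Function.Injective ρ) (Γ : Ctx) : (Γ.shift).remap ρ = (Γ.remap ρ).shift :=
  remap_eq_of hρ _ _ (fun i => by simp [Ctx.shift, remap_apply hρ])
    fun j hj => by simp [Ctx.shift, remap_of_forall_ne Γ hj]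

/-- Transport commutes with type substitution. [folklore] -/
theorem remap_substT (hρ : Function.Injective ρ) (θ : ℕ → LinTy) (Γ : Ctx) :
    (Γ.substT θ).remap ρ = (Γ.remap ρ).substT θ :=
  remap_eq_of hρ _ _ (fun i => by simp [remap_apply hρ])
    fun j hj => by simp [remap_of_forall_ne Γ hj]

/-- Transport commutes with the multiplexor's context operation. [folklore] -/
theorem remap_mpx (hρ : Function.Injective ρ) (Γ : Ctx) (S : Finset ℕ) (j : ℕ) (σ : SoftTy) :
    (Γ.mpx S j σ).remap ρ = (Γ.remap ρ).mpx (S.image ρ) (ρ j) σ := by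
  refine remap_eq_of hρ _ _ (fun i => ?_) (fun j' hj' => ?_)
  · have hiS : ρ i ∈ S.image ρ ↔ i ∈ S := by
      constructor
      · intro h
        obtain ⟨i', hi', e⟩ := Finset.mem_image.1 h
        exact hρ e ▸ hi'
      · exact fun h => Finset.mem_image.2 ⟨i, h, rfl⟩
    by_cases h : i ∈ S
    · rw [mpx_of_mem Γ σ h, mpx_of_mem _ σ (hiS.2 h)]
    · by_cases hij : i = j
      · subst hij
        by_cases hjS : ρ i ∈ S.image ρ
        · exact absurd (hiS.1 hjS) h
        · rw [mpx_self _ σ hjS, mpx_self Γ σ h]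
      · rw [mpx_of_ne _ σ (mt hiS.1 h) (hρ.ne hij), mpx_of_ne Γ σ h hij, remap_apply hρ]
  · have h1 : j' ∉ S.image ρ := fun h => by
      obtain ⟨i, _, e⟩ := Finset.mem_image.1 h
      exact hj' i e
    rw [mpx_of_ne _ σ h1 (fun e => hj' j e.symm), remap_of_forall_ne Γ hj']

/-- Splits are transported. [folklore] -/
theorem Split.remap {Γ Γ₁ Γ₂ : Ctx} (h : Γ.Split Γ₁ Γ₂) (hρ : Function.Injective ρ) :
    (Γ.remap ρ).Split (Γ₁.remap ρ) (Γ₂.remap ρ) := by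
  intro j
  by_cases hj : ∃ i, ρ i = j
  · obtain ⟨i, rfl⟩ := hj
    simp only [remap_apply hρ]
    exact h i
  · push Not at hj
    simp [remap_of_forall_ne _ hj]

/-- Singleton contexts are transported. [folklore] -/
theorem IsSingleton.remap {Γ : Ctx} {i : ℕ} {σ : SoftTy} (h : Γ.IsSingleton i σ)
    (hρ : Function.Injective ρ) : (Γ.remap ρ).IsSingleton (ρ i) σ := by
  refine ⟨by rw [remap_apply hρ, h.1], fun j hj => ?_⟩
  by_cases hj' : ∃ i', ρ i' = j
  · obtain ⟨i', rfl⟩ := hj'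
    rw [remap_apply hρ]
    exact h.2 i' fun e => hj (e ▸ rfl)
  · push Not at hj'
    exact remap_of_forall_ne _ hj'

end Ctx

/-- Rule `(m)`'s renaming followed by an injective renaming is the injective renaming followed by
the transported multiplexor renaming. [folklore] -/
theorem Term.rename_mpxRen_rename {ρ : ℕ → ℕ} (hρ : Function.Injective ρ) (M : Term)
    (S : Finset ℕ) (j : ℕ) :
    (M.rename (mpxRen S j)).rename ρ = (M.rename ρ).rename (mpxRen (S.image ρ) (ρ j)) := by
  rw [Term.rename_rename, Term.rename_rename]
  congr 1
  funext i
  by_cases h : i ∈ S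
  · have : ρ i ∈ S.image ρ := Finset.mem_image.2 ⟨i, h, rfl⟩
    simp [mpxRen, h, this]
  · have : ρ i ∉ S.image ρ := fun h' => by
      obtain ⟨i', hi', e⟩ := Finset.mem_image.1 h'
      exact h (hρ e ▸ hi')
    simp [mpxRen, h, this]

/-- **Invariance of typing under injective renaming of variable slots**: the derivation is replayed
on the transported context, with the same degree, rank bound and weight. [folklore] -/
theorem WTyping.rename {r w d : ℕ} {Γ : Ctx} {M : Term} {σ : SoftTy} (h : WTyping r w d Γ M σ)
    {ρ : ℕ → ℕ} (hρ : Function.Injective ρ) : WTyping r w d (Γ.remap ρ) (M.rename ρ) σ := by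
  induction h generalizing ρ with
  | ax hΓ => exact WTyping.ax (hΓ.remap hρ)
  | weak j A _ hj hΓ' ih =>
    subst hΓ'
    refine WTyping.weak (ρ j) A (ih hρ) ?_ (Ctx.remap_update hρ _ _ _)
    rw [Ctx.remap_apply hρ]
    exact hj
  | lam _ ih =>
    refine WTyping.lam ?_
    have := ih (liftRen_injective hρ)
    rwa [Ctx.remap_cons_liftRen hρ] at this
  | app hs _ _ ih₁ ih₂ => exact WTyping.app (hs.remap hρ) (ih₁ hρ) (ih₂ hρ)
  | @mpx w d Γ Γ' M M' μ σ S j _ hS hj hr hΓ' hM' ih =>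
    subst hΓ' hM'
    refine WTyping.mpx (S.image ρ) (ρ j) (ih hρ) ?_ ?_ (Finset.card_image_le.trans hr)
      (Ctx.remap_mpx hρ _ _ _ _) (Term.rename_mpxRen_rename hρ _ _ _)
    · intro i hi
      obtain ⟨i₀, hi₀, rfl⟩ := Finset.mem_image.1 hi
      rw [Ctx.remap_apply hρ]
      exact hS i₀ hi₀
    · rw [Ctx.remap_apply hρ]
      exact hj
  | sp _ hΓ' ih =>
    subst hΓ'
    exact WTyping.sp (ih hρ) (Ctx.remap_bang hρ _)
  | allI _ hΔ ih =>
    subst hΔ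
    exact WTyping.allI (ih hρ) (Ctx.remap_shift hρ _)
  | allE A _ ih => exact WTyping.allE A (ih hρ)
  | sum _ _ ih₁ ih₂ => exact WTyping.sum (ih₁ hρ) (ih₂ hρ)

/-- Shifting a derivation under a new binder that it does not use. [folklore] -/
theorem WTyping.shift_succ {r w d : ℕ} {Γ : Ctx} {M : Term} {σ : SoftTy} (h : WTyping r w d Γ M σ) :
    WTyping r w d (Ctx.cons none Γ) (M.rename Nat.succ) σ := by
  have := h.rename Nat.succ_injective
  rwa [Ctx.remap_succ] at this

end STA

end Literature.Computability.ImplicitComplexity
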